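import Mathlib
import Summits.Ventures.FusionMHD.Models.CerfonFreidbergIterLikeQHalfShearDefs
import HarnessLib

/-!
# Ventures/FusionMHD — Models/CerfonFreidbergIterLikeQHalfShearPanels16.lean: KERNEL CHECK of the shear-register certificates of panels 30, 31 (of 32)
# at `ψ_N = 1/2` of THE Cerfon–Freidberg ITER-like instance

HONEST FRAMING (LADDER-GRIDFUSION three columns; CF rung; successor step of «q′(ψ_N = 1/2) on the CF rung», F2-SCOPING v1.6 §10(c)).  One `decide +kernel`
(≈ 110 s): for each listed panel the obligation `CFIterLike.QHalfShear.ShearCert.ok` (`Models/CerfonFreidbergIterLikeQHalfShearDefs.lean`) — the Taylor-model run of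
`progQ = CFIterLike.QHalf.progA ++ blockQ` over ★ #117's parameter box is ACCEPTED and the kernel's panel-integral enclosure of the shear kernel `K·p` along the
approximant lies inside the claimed integers (read off a compiled `#eval` of the same functions, slack one unit of `2⁻⁶⁰`; float truth inside every panel).
MODELLED: analytic Cerfon–Freidberg family; nothing about a device or stability.  No `native_decide`.  Typer/prover: gridfusion-model-5 (g8), 2026-08-27.
Citations: Freidberg 2014 §6.3.5 (6.35) [Freidberg2014]; Mahboubi–Melquiond–Sibut-Pinote 2016 §3.2 Lemma 3 [MahboubiMelquiondSibutpinote2016].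
-/

namespace Summit.Ventures.FusionMHD.Models.CFIterLike.QHalfShear

/-- Shear-register certificate data of panels 30, 31. [instance data] -/
def shearCert16 : List ShearCert := [
  { j := 30, cand := [770286583785756819456, -901700155134050566144, 10156892089973989179392, -11650597357616065675264, 66280321698044483469312, -51578477062413818527744, 154305697342915644227584, 331146421529519432138752, -1189807562257256106950656, 8617298446212839187152896, -2340586439724290815253544960, 130966184841000560732667904, 3167405478962240472012684263424],
    deg := 12, elog2 := 43, plo := 5622231012120609189, phi := 5622231184811803844 },
  { j := 31, cand := [751733570500371546112, -293152696643552608256, 9439644766439675527168, -3766488534561026211840, 60739063778312800174080, -18207879650546552930304, 191927363517266903695360, 58699499666296333664256, -139505931704969069592576, 19646256011213652287815680, -1224372521979652143168094208, -27230143296477336291462086656, 1215056757604186513427784531968],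
    deg := 12, elog2 := 45, plo := 5502946566111236139, phi := 5502947236277142752 }]

/-- **KERNEL CHECK** of the shear register on panels 30, 31. -/
theorem shearCert16_ok : CFIterLike.QHalfShear.shearCert16.all ShearCert.ok = true := by
  decide +kernel

end Summit.Ventures.FusionMHD.Models.CFIterLike.QHalfShear
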